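import Summits.CriticalPhenomena.SAWScalingLimit.Theses.SAWTwistedSelfEnergy
import Summits.CriticalPhenomena.SAWScalingLimit.Theorems.SubseqIdentification.Negative.Necessity
import Summits.CriticalPhenomena.SAWScalingLimit.Theorems.EventualTight.Negative.TightnessNecessary
import Summits.CriticalPhenomena.SAWScalingLimit.Theorems.SAWParafermionAssembly

/-!
# `SubseqIdentification` (stmt-CriticalPhenomena-0783) — negative knowledge: the along-the-mesh split
of the summit is lossless, and route `SAWTwistedSelfEnergy`'s kernel cruxes are idle in its `closes`

Refuter crux-attack (route `SAWTwistedSelfEnergy`, 2026-08-17), support file for the crux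
`Summit.CriticalPhenomena.SAWScalingLimit.Theses.SAWTwistedSelfEnergy.SubseqIdentification`
(syntactically the shared statement of `SAWRenewalTightness` / `SAWParafermion` / …; `Iff.rfl`).

* `eventualTightAlongMesh_of_sawScalingLimit` — tightness ALONG THE MESH FILTER (the twin item
  stmt-CriticalPhenomena-1881, `IsTightAlongMesh`, which is the form this route, `SAWParafermion`,
  `SAWLeftRightFKG`, `SAWAsymptoticMorera`, `SAWTotalPositivity`, `SAWTargetMonotonicity`,
  `SAWExcursionCardy` carry) is NECESSARY for the summit conjunct: the landed set-form necessity
  `EventualTight.Negative.exists_isTightMeasureSet_image_of_convergesInLawToSLE` (stmt-1372 form)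
  pushed through the Literature bridge `isTightAlongMesh_of_isTightMeasureSet_image`.
* `sawScalingLimit_iff_eventualTightAlongMesh_and_subseqIdentification` —
  **`SAWScalingLimit ↔ EventualTight ∧ SubseqIdentification`** for this route's decls: the pair
  (tightness along the mesh, identification of subsequential limits) is EXACTLY the Lawler–Schramm–Werner
  conjecture as typed (⇐ is the landed `parafermion_assembly_proof`, Prokhorov + uniqueness of the SLE law).
  CONSEQUENCES recorded for the planner: (i) restates-the-summit probe — `S → C` holds (`Necessity`),
  `C → S` is open and its gap is precisely `EventualTight`; (ii) in route `SAWTwistedSelfEnergy` the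
  deciding theorem `closes h₁ … h₆` already follows from `h₅ ∧ h₆` alone
  (`sawScalingLimit_of_ident_of_tight`), so the kernel cruxes `TwistedKernelSummable`,
  `TwistedKernelTailIndex`, `TwistedGapEquation` and the glue `DomainTransfer` (h₁–h₄) are idle binders:
  no typed implication from the route's target `ObservableLimitFlat` to the crux exists in the route file
  (the martingale-principle step "observable limit ⇒ identification" is informal there).
Everything proved, standard axioms. [folklore]
-/

noncomputable section

open Literature.Probability.RandomPlanarGeometry Literature.Probability.RandomPlanarGeometry.SAW
  Literature.Probability.LatticeModels MeasureTheory Filter Topology Set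
open scoped NNReal ENNReal BoundedContinuousFunction

namespace Summit.CriticalPhenomena.SAWScalingLimit.Theorems.SubseqIdentification.Negative

open Summit.CriticalPhenomena.SAWScalingLimit.Theses.SAWTwistedSelfEnergy
  (SubseqIdentification EventualTight TwistedKernelSummable TwistedKernelTailIndex TwistedGapEquation
    DomainTransfer)

/-- **Tightness along the mesh is necessary.** If the critical `δℤ²` SAW converges to chordal
SLE_{8/3} in every Dobrushin domain (`SAWScalingLimit`), then for every endpoint approximation the
pushed laws are tight along `𝓝[>] 0` (`IsTightAlongMesh`, item stmt-CriticalPhenomena-1881): the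
set-form necessity on an initial mesh interval (`exists_isTightMeasureSet_image_of_convergesInLawToSLE`)
followed by the bridge `isTightAlongMesh_of_isTightMeasureSet_image` (every map out of the discrete
space of SAWs is measurable). [folklore] -/
theorem eventualTightAlongMesh_of_sawScalingLimit (h : SAW.SAWScalingLimit) : EventualTight := by
  intro D a b hab
  obtain ⟨δ₀, hδ₀, hT⟩ :=
    EventualTight.Negative.exists_isTightMeasureSet_image_of_convergesInLawToSLE hab (h D a b hab)
  exact isTightAlongMesh_of_isTightMeasureSet_image
    (Eventually.of_forall fun δ => (DomainSAW.measurable_of_top _).aemeasurable) hδ₀ hT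

/-- **The effective content of route `SAWTwistedSelfEnergy`'s deciding theorem**: identification of
subsequential limits (h₅) and tightness along the mesh (h₆) ALONE give the summit — the landed
`parafermion_assembly_proof` (Prokhorov + subsequence principle + uniqueness of the SLE law), read on
this route's (syntactically identical) decls. Hence the binders h₁–h₄ of `SAWTwistedSelfEnergy.closes`
are idle. [folklore] -/
theorem sawScalingLimit_of_ident_of_tight (hI : SubseqIdentification) (hT : EventualTight) :
    SAW.SAWScalingLimit :=
  parafermion_assembly_proof hI hT

/-- **`SAWScalingLimit ↔ EventualTight ∧ SubseqIdentification` (along-the-mesh form).** The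
Lawler–Schramm–Werner conjecture on `δℤ²` as typed is EXACTLY the conjunction of tightness along the
mesh filter (stmt-1881) and identification of subsequential limits (stmt-0783): the route split is
lossless, the crux is necessary (`subseqIdentification_of_sawScalingLimit`), and the only gap between
the crux and the summit is tightness. [folklore] -/
theorem sawScalingLimit_iff_eventualTightAlongMesh_and_subseqIdentification :
    SAW.SAWScalingLimit ↔ (EventualTight ∧ SubseqIdentification) :=
  ⟨fun h => ⟨eventualTightAlongMesh_of_sawScalingLimit h, subseqIdentification_of_sawScalingLimit h⟩,
    fun h => sawScalingLimit_of_ident_of_tight h.2 h.1⟩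

/-- The idle-binder certificate in the shape of the route's own deciding theorem: whatever
inhabitants h₁–h₄ of the kernel-crux / glue types are supplied, `closes` needs only h₅, h₆ — the
conclusion is reached without touching h₁–h₄ (they are cleared first). [folklore] -/
theorem closes_hyps_one_to_four_idle :
    (SubseqIdentification → EventualTight → SAW.SAWScalingLimit) ∧
      ∀ (_ : TwistedKernelSummable) (_ : TwistedKernelTailIndex) (_ : TwistedGapEquation)
        (_ : DomainTransfer), (SubseqIdentification ∧ EventualTight ↔ SAW.SAWScalingLimit) :=
  ⟨sawScalingLimit_of_ident_of_tight, fun _ _ _ _ =>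
    ⟨fun h => sawScalingLimit_of_ident_of_tight h.1 h.2,
      fun h => ⟨subseqIdentification_of_sawScalingLimit h, eventualTightAlongMesh_of_sawScalingLimit h⟩⟩⟩

end Summit.CriticalPhenomena.SAWScalingLimit.Theorems.SubseqIdentification.Negative

end
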